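import Mathlib.Algebra.Group.Subgroup.Pointwise
import Literature.Topology.FourManifolds.GroupTrisections
import HarnessLib

/-!
# Stub `stub_kerFaceChar` of line `power-twist-absorption` for crux `CongruenceShadows.ShadowsStandard`
(item stmt-SmoothPoincare4-14593, route route-SmoothPoincare4-CongruenceShadows)

**The kernel of the standard face character.**  Let
`S₃ = ⟨a₁,b₁,a₂,b₂,a₃,b₃ ∣ [a₁,b₁][a₂,b₂][a₃,b₃]⟩` be the genus-3 surface group (`SurfaceGroup 3`;
`aᵢ₊₁ = SurfaceGroup.a i`, `bᵢ₊₁ = SurfaceGroup.b i`) and `N₀ = ⟪a₁,a₂,b₃⟫`, `N₂ = ⟪b₁,a₂,a₃⟫`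
(`s4Kernels 0`, `s4Kernels 2`).  If a character `f : S₃ →* ℤ` kills `a₁, a₂, a₃, b₁, b₃` and
takes the value `±1` on `b₂`, then `ker f = N₂ ⊔ N₀`.

Proof.  `⊇`: `ker f` is normal and contains the normal generators of `N₂` and of `N₀`.
`⊆`: the erased set `S = {a₁,a₂,a₃,b₁,b₃}` (`= s4Gens 2 ∪ s4Gens 0`) meets every handle, so by
the tree's `quotientEquivFreeGroupErase` the quotient `S₃ ⧸ (N₂ ⊔ N₀)` is the free group on the
single surviving generator `b₂`; every element of that free group is a power `b₂ⁿ`, on which the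
induced character takes the value `±n`, so the induced character is injective and `ker f ≤ N₂ ⊔ N₀`.

This is the registered stub `stub_kerFaceChar` (STUB F3) of the checked skeleton of the line.
Pure group theory over the tree's `SurfaceGroup`; no definitions, no named facts.
-/

-- the prescribed namespace `Summit.<P>.<Sub>.…` duplicates `SmoothPoincare4` (P = Sub)
set_option linter.dupNamespace false

open Literature.Topology.FourManifolds Subgroup

namespace Summit.SmoothPoincare4.SmoothPoincare4.Theorems.ShadowsStandard.PowerTwistAbsorption

/-- In the free group on a one-element type `{u}` every element is a power of `of u`. [folklore] -/
private theorem exists_eq_of_zpow {I : Type*} (u : I) (hu : ∀ y : I, y = u) (w : FreeGroup I) :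
    ∃ n : ℤ, w = FreeGroup.of u ^ n := by
  induction w using FreeGroup.induction_on with
  | C1 => exact ⟨0, (zpow_zero _).symm⟩
  | of x => exact ⟨1, by rw [hu x, zpow_one]⟩
  | inv_of x _ => exact ⟨-1, by rw [hu x, zpow_neg, zpow_one]⟩
  | mul x y hx hy =>
    obtain ⟨m, rfl⟩ := hx
    obtain ⟨n, rfl⟩ := hy
    exact ⟨m + n, (zpow_add _ _ _).symm⟩

/-- **One surviving generator.** If the erased set `S` meets every handle of `S_g`, the normal
subgroup `N` contains the erased generators and dies under erasing, exactly one generator `u`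
survives, and a character `f : S_g →* ℤ` killing `N` is nontrivial on `u`, then `ker f ≤ N`:
indeed `S_g ⧸ N ≅ F⟨u⟩ = ⟨u⟩ ≅ ℤ` (`quotientEquivFreeGroupErase`) and the induced character
`uⁿ ↦ n • f u` is injective. [folklore] -/
private theorem ker_le_of_erase {g : ℕ} (S : Finset (surfaceGen g))
    (hS : ∀ i : Fin g, (i, false) ∈ S ∨ (i, true) ∈ S) (N : Subgroup (SurfaceGroup g)) [N.Normal]
    (hN₁ : ∀ x ∈ S, (PresentedGroup.of x : SurfaceGroup g) ∈ N) (hN₂ : N ≤ (eraseHom S hS).ker)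
    (u : {x // x ∉ S}) (hu : ∀ y, y = u) (f : SurfaceGroup g →* Multiplicative ℤ)
    (hf : N ≤ f.ker) (hfu : f (PresentedGroup.of u.1) ≠ 1) : f.ker ≤ N := by
  intro x hx
  obtain ⟨n, hn⟩ :=
    exists_eq_of_zpow u hu (quotientEquivFreeGroupErase S hS N hN₁ hN₂ (QuotientGroup.mk x))
  -- the surviving generator goes to itself
  have hgu : quotientEquivFreeGroupErase S hS N hN₁ hN₂
      (QuotientGroup.mk (PresentedGroup.of u.1)) = FreeGroup.of u := by
    show QuotientGroup.lift N (eraseHom S hS) hN₂ (QuotientGroup.mk (PresentedGroup.of u.1)) =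
      FreeGroup.of u
    rw [QuotientGroup.lift_mk, eraseHom_of, eraseGen_of_not_mem u.2]
  -- hence `x ≡ uⁿ (mod N)`
  have hxu : (QuotientGroup.mk x : SurfaceGroup g ⧸ N) =
      QuotientGroup.mk (PresentedGroup.of u.1 ^ n) := by
    apply (quotientEquivFreeGroupErase S hS N hN₁ hN₂).injective
    rw [hn, QuotientGroup.mk_zpow, map_zpow, hgu]
  -- apply the induced character: `(f u) ^ n = f x = 1`
  have h1 : f (PresentedGroup.of u.1) ^ n = 1 := by
    have h := congrArg (QuotientGroup.lift N f hf) hxu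
    rw [QuotientGroup.lift_mk, QuotientGroup.lift_mk, map_zpow] at h
    rw [← h]
    exact hx
  -- `ℤ` is torsion-free, so `n = 0`
  have hn0 : n = 0 := by
    have h2 : n * Multiplicative.toAdd (f (PresentedGroup.of u.1)) = 0 := by
      rw [← smul_eq_mul, ← toAdd_zpow, h1, toAdd_one]
    rcases mul_eq_zero.1 h2 with h | h
    · exact h
    · exact absurd (toAdd_eq_zero.1 h) hfu
  rw [← QuotientGroup.eq_one_iff, hxu, hn0, zpow_zero, QuotientGroup.mk_one]

/-- **STUB F3 · `stub_kerFaceChar`** (def-free, genus 3): the kernel of `±` the standard face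
character of `S₃` (`b₂ ↦ ±1`, all other generators `↦ 0`) is
`N₂ ⊔ N₀ = ⟪b₁,a₂,a₃⟫ ⊔ ⟪a₁,a₂,b₃⟫` (`s4Kernels 2 ⊔ s4Kernels 0`). `⊇` from the generator values
(`ker f` is normal); `⊆`: `S₃ ⧸ (N₂ ⊔ N₀)` is the free group on the surviving generator `b₂`
(`quotientEquivFreeGroupErase` with the erased set `{a₁,a₂,a₃,b₁,b₃} = s4Gens 2 ∪ s4Gens 0`), on
which the induced character `b₂ⁿ ↦ ±n` is injective. [folklore] -/
theorem stub_kerFaceChar :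
    ∀ f : SurfaceGroup 3 →* Multiplicative ℤ,
      f (SurfaceGroup.a 0) = 1 → f (SurfaceGroup.a 1) = 1 → f (SurfaceGroup.a 2) = 1 →
      f (SurfaceGroup.b 0) = 1 → f (SurfaceGroup.b 2) = 1 →
      (f (SurfaceGroup.b 1) = Multiplicative.ofAdd 1 ∨ f (SurfaceGroup.b 1) = Multiplicative.ofAdd (-1)) →
      f.ker = s4Kernels 2 ⊔ s4Kernels 0 := by
  intro f ha0 ha1 ha2 hb0 hb2 hb1
  -- the erased generators `a₁,a₂,a₃,b₁,b₃` (`= s4Gens 2 ∪ s4Gens 0`) die under `f`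
  have hgen : ∀ x ∈ s4Gens 2 ∪ s4Gens 0, f (PresentedGroup.of x) = 1 := by
    have key : ∀ x ∈ s4Gens 2 ∪ s4Gens 0, x = ((0 : Fin 3), false) ∨ x = ((1 : Fin 3), false) ∨
        x = ((2 : Fin 3), false) ∨ x = ((0 : Fin 3), true) ∨ x = ((2 : Fin 3), true) := by
      decide
    intro x hx
    rcases key x hx with rfl | rfl | rfl | rfl | rfl
    exacts [ha0, ha1, ha2, hb0, hb2]
  -- `⊇`: `ker f` is normal and contains the normal generators of `N₂` and `N₀`
  have hle : s4Kernels 2 ⊔ s4Kernels 0 ≤ f.ker := by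
    refine sup_le ?_ ?_
    · rw [s4Kernels_eq]
      refine normalClosure_le_normal ?_
      rintro _ ⟨x, hx, rfl⟩
      exact hgen x (Finset.mem_union_left _ hx)
    · rw [s4Kernels_eq]
      refine normalClosure_le_normal ?_
      rintro _ ⟨x, hx, rfl⟩
      exact hgen x (Finset.mem_union_right _ hx)
  refine le_antisymm ?_ hle
  -- `⊆`: erase `S = s4Gens 2 ∪ s4Gens 0`; the single survivor is `b₂ = (1, true)`
  haveI : (s4Kernels 2).Normal := by rw [s4Kernels_eq]; infer_instance
  haveI : (s4Kernels 0).Normal := by rw [s4Kernels_eq]; infer_instance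
  have hS : ∀ i : Fin 3, (i, false) ∈ s4Gens 2 ∪ s4Gens 0 ∨ (i, true) ∈ s4Gens 2 ∪ s4Gens 0 :=
    fun k => (s4Gens_hits 2 k).imp (Finset.mem_union_left _) (Finset.mem_union_left _)
  have hu : ((1 : Fin 3), true) ∉ s4Gens 2 ∪ s4Gens 0 := by decide
  refine ker_le_of_erase (s4Gens 2 ∪ s4Gens 0) hS (s4Kernels 2 ⊔ s4Kernels 0) ?_ ?_
    ⟨((1 : Fin 3), true), hu⟩ ?_ f hle ?_
  · intro x hx
    rw [Finset.mem_union] at hx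
    rcases hx with hx | hx
    · exact mem_sup_left (of_mem_s4Kernels 2 hx)
    · exact mem_sup_right (of_mem_s4Kernels 0 hx)
  · exact sup_le (s4Kernels_le_ker _ hS 2 Finset.subset_union_left)
      (s4Kernels_le_ker _ hS 0 Finset.subset_union_right)
  · rintro ⟨y, hy⟩
    have key : ∀ y, y ∉ s4Gens 2 ∪ s4Gens 0 → y = ((1 : Fin 3), true) := by decide
    exact Subtype.ext (key y hy)
  · show f (SurfaceGroup.b 1) ≠ 1
    rcases hb1 with h | h <;> rw [h] <;> decide

end Summit.SmoothPoincare4.SmoothPoincare4.Theorems.ShadowsStandard.PowerTwistAbsorption
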